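import Literature.NumberTheory.Rogawski1990.EndoscopicStableOrbitalSum
import Literature.NumberTheory.Rogawski1990.StableClassRegrouping
import HarnessLib

/-!
# Regrouping on the endoscopic group `H = U(J₂) × U(J₁)`, II: `ConjClasses H ≅ ConjClasses U(J₂) × ConjClasses U(J₁)`,
# `StableClassH ≅ StableClass × StableClass`, the fibres of `[γ_H] ↦ 𝒪′_st(γ_H)`, and `Φ^st_H(𝒪′_st(g, u))` as the `U(J₂)`-stable sum of a `u`-slice

Topic `NumberTheory/Rogawski1990`; namespace `Literature.NumberTheory.Rogawski1990`.  THEOREMS ONLY (no definition, no named fact, no instance, no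
notation, no `sorry`; the bijections appear as `Equiv.ofBijective _ ‹bijectivity theorem›`).  Cell `pub/hodgecm-mathlib`, F0∕P3a, LEAD WORD H-2 item 2
«(G3)-H»: the `H`-side companion of ★ `StableClassRegrouping` (p08) BEYOND what ★ `EndoscopicStableOrbitalSum` already twins (`StableClassH.ofConjClass`,
`StableClassH.orbitalSum`, `finsum_stableClassH_orbitalSum`, `orbitalSum_mul_of_fibrewise` are NOT restated here).  Print: [Rogawski1990 §3.1 p. 19]
stable conjugacy on `H(F) = U(J₂)(F) × U(J₁)(F)` is componentwise (★ `IsStablyConjH`), and on the `U(1)`-factor conjugacy = stable conjugacy = equality;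
[§4.3 (4.3.1) p. 43] `Φ^st(γ_H, f^H) = Σ_{[γ′_H] ⊂ 𝒪′_st(γ_H)} Φ(γ′_H, f^H)`; [§5.2 p. 69] the geometric side regrouped by stable classes.  USE (F0P3a-p02 (g7)'s
census `CENSUS-HsideKitDock` (ii)): the elliptic part of `J_H(f^H)` arrives as `Σ_{γ₁ ∈ U(J₁)} Σ_{[g] ⊂ U(J₂)} …` per `U(J₁)`-SLICE (★ `tsum_pair_eq_sum_kernel_slice`,
★ `…EllipticKitTwo`); to read it in the kit's `StableClassH` currency one needs exactly: (§1) `ConjClasses (U₂ × U₁) ≅ ConjClasses U₂ × ConjClasses U₁`,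
(§2) `ConjClasses U₁ ≅ U₁ ≅ StableClass U₁`, (§3) `StableClassH ≅ StableClass U₂ × StableClass U₁` compatibly with `[·] ↦ 𝒪_st(·)`, (§4) the fibre of
`[γ_H] ↦ 𝒪′_st(γ_H)` over `𝒪′_st(g, u)` = `conjClassesIn g ×ˢ {[u]}` and **`Φ^st_H(𝒪′_st(g, u)) = (𝒪_st(g)).orbitalSum (u-slice of Φ)`**, (§5) the all-classes
regrouping `Σᶠ_{𝒪′_st} Φ^st_H = Σᶠ_{(𝒪_st, u)} (𝒪_st).orbitalSum (u-slice)` and the summable (`tsum`) twins of ★ `StableClassRegrouping` §3.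

* §1 (any monoids `A`, `B`): `isConj_prod_iff`, `ConjClasses.mk_prod_eq_mk_prod_iff`, **`ConjClasses.prod_bijective`** (`c ↦ (c.map fst, c.map snd)`),
  `ConjClasses.prodEquiv_symm_apply_mk`, `finsum_conjClasses_prod`, `hasSum_conjClasses_prod_iff`, `tsum_conjClasses_prod`.
* §2 (`U(σ, J₁) ⊂ GL₁`): `isConj_iff_eq_unitaryGroup_fin_one`, `ConjClasses.mk_bijective_unitaryGroup_fin_one`, `stableClassOf_bijective_fin_one`,
  `StableClass.ofConjClass_bijective_fin_one`.
* §3 `stableClassHOf_mk_eq_iff`, **`StableClassH.prod_bijective`** (`s ↦ (s.fst, s.snd)`), `StableClassH.prodEquiv_symm_apply_mk`,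
  `StableClassH.fst_ofConjClass` ∕ `snd_ofConjClass`, `finsum_stableClassH_prod`, `tsum_stableClassH_prod`.
* §4 **`StableClassH.ofConjClass_preimage_eq`**, **`StableClassH.orbitalSum_stableClassHOf_eq_slice`**.
* §5 **`finsum_stableClassH_orbitalSum_eq_finsum_slice`**, `hasSum_stableClassH_tsum_fibre`, `tsum_stableClassH_tsum_fibre`, `StableClassH.tsum_fibre_eq_orbitalSum`.

HONEST LABEL: HC_CM is proved only modulo the printed citations (named inputs remaining 2) until rung 0 closes; this file is bookkeeping of conjugacy and
stable classes on a product group and proves none of them.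

## References
* [Rogawski1990] J. D. Rogawski, *Automorphic Representations of Unitary Groups in Three Variables*, Ann. of Math. Stud. 123 (1990), §3.1 p. 19, §4.1 (4.1.1)
  p. 39, §4.3 (4.3.1) p. 43, §5.2 p. 69, §14.5 p. 237.
-/

set_option autoImplicit false

noncomputable section

namespace Literature.NumberTheory.Rogawski1990

open scoped MatrixGroups
open Literature.AlgebraicGeometry.ShimuraVarieties (unitaryGroup)

/-! ## §1 Conjugacy classes of a product of monoids -/

section Prod

variable {A B : Type*} [Monoid A] [Monoid B]

/-- Conjugacy in a product is componentwise: `(a, b) ∼ (a′, b′) ↔ a ∼ a′ ∧ b ∼ b′` (for `H(F) = U(J₂)(F) × U(J₁)(F)`). [cite: Rogawski1990, §3.1 p. 19] -/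
theorem isConj_prod_iff {a a' : A} {b b' : B} : IsConj (a, b) (a', b') ↔ IsConj a a' ∧ IsConj b b' := by
  constructor
  · rintro ⟨c, hc⟩
    refine ⟨⟨Units.map (MonoidHom.fst A B) c, ?_⟩, ⟨Units.map (MonoidHom.snd A B) c, ?_⟩⟩
    · exact congrArg Prod.fst hc
    · exact congrArg Prod.snd hc
  · rintro ⟨⟨c, hc⟩, ⟨d, hd⟩⟩
    refine ⟨MulEquiv.prodUnits.symm (c, d), ?_⟩
    change SemiconjBy ((c : A), (d : B)) (a, b) (a', b')
    exact Prod.ext hc hd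

/-- `[(a, b)] = [(a′, b′)] ↔ [a] = [a′] ∧ [b] = [b′]`. [cite: Rogawski1990, §3.1 p. 19] -/
theorem ConjClasses.mk_prod_eq_mk_prod_iff {a a' : A} {b b' : B} :
    ConjClasses.mk (a, b) = ConjClasses.mk (a', b') ↔ ConjClasses.mk a = ConjClasses.mk a' ∧ ConjClasses.mk b = ConjClasses.mk b' := by
  rw [ConjClasses.mk_eq_mk_iff_isConj, ConjClasses.mk_eq_mk_iff_isConj, ConjClasses.mk_eq_mk_iff_isConj, isConj_prod_iff]

/-- The two projections of a class of the product: `[(a, b)] ↦ ([a], [b])` (Mathlib `ConjClasses.map` along `fst`, `snd`). [cite: Rogawski1990, §3.1 p. 19] -/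
@[simp] theorem ConjClasses.map_fst_map_snd_mk (a : A) (b : B) :
    ((ConjClasses.mk (a, b)).map (MonoidHom.fst A B), (ConjClasses.mk (a, b)).map (MonoidHom.snd A B)) =
      (ConjClasses.mk a, ConjClasses.mk b) := rfl

/-- **`ConjClasses (A × B) ≅ ConjClasses A × ConjClasses B`**: `[(a, b)] ↦ ([a], [b])` is a bijection (the classes of `H = U(J₂) × U(J₁)`). [cite: Rogawski1990, §3.1 p. 19; §4.3 (4.3.1) p. 43] -/
theorem ConjClasses.prod_bijective :
    Function.Bijective (fun c : ConjClasses (A × B) => (c.map (MonoidHom.fst A B), c.map (MonoidHom.snd A B))) := by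
  constructor
  · intro c c' h
    obtain ⟨⟨a, b⟩, rfl⟩ := ConjClasses.mk_surjective c
    obtain ⟨⟨a', b'⟩, rfl⟩ := ConjClasses.mk_surjective c'
    have h' : (ConjClasses.mk a, ConjClasses.mk b) = (ConjClasses.mk a', ConjClasses.mk b') := h
    rw [Prod.mk.injEq] at h'
    exact ConjClasses.mk_prod_eq_mk_prod_iff.2 h'
  · rintro ⟨ca, cb⟩
    obtain ⟨a, rfl⟩ := ConjClasses.mk_surjective ca
    obtain ⟨b, rfl⟩ := ConjClasses.mk_surjective cb
    exact ⟨ConjClasses.mk (a, b), rfl⟩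

/-- The inverse bijection sends `([a], [b])` to `[(a, b)]`. [cite: Rogawski1990, §3.1 p. 19] -/
@[simp] theorem ConjClasses.prodEquiv_symm_apply_mk (a : A) (b : B) :
    (Equiv.ofBijective _ (ConjClasses.prod_bijective (A := A) (B := B))).symm (ConjClasses.mk a, ConjClasses.mk b) = ConjClasses.mk (a, b) :=
  (Equiv.ofBijective _ ConjClasses.prod_bijective).symm_apply_eq.2 rfl

/-- **Re-indexing a class sum over a product**: `Σᶠ_{[(a,b)]} F = Σᶠ_{([a],[b])} F[(a, b)]`. [cite: Rogawski1990, §4.3 (4.3.1) p. 43; §5.2 p. 69] -/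
theorem finsum_conjClasses_prod {M : Type*} [AddCommMonoid M] (F : ConjClasses (A × B) → M) :
    ∑ᶠ c : ConjClasses (A × B), F c =
      ∑ᶠ p : ConjClasses A × ConjClasses B, F ((Equiv.ofBijective _ (ConjClasses.prod_bijective (A := A) (B := B))).symm p) :=
  (finsum_comp_equiv (Equiv.ofBijective _ (ConjClasses.prod_bijective (A := A) (B := B))).symm).symm

/-- The same for `HasSum` (any topological additive commutative monoid). [cite: Rogawski1990, §5.2 p. 69] -/
theorem hasSum_conjClasses_prod_iff {M : Type*} [AddCommMonoid M] [TopologicalSpace M] (F : ConjClasses (A × B) → M) (m : M) :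
    HasSum (fun p : ConjClasses A × ConjClasses B => F ((Equiv.ofBijective _ (ConjClasses.prod_bijective (A := A) (B := B))).symm p)) m ↔
      HasSum F m :=
  (Equiv.ofBijective _ (ConjClasses.prod_bijective (A := A) (B := B))).symm.hasSum_iff

/-- The same for `tsum`. [cite: Rogawski1990, §5.2 p. 69] -/
theorem tsum_conjClasses_prod {M : Type*} [AddCommMonoid M] [TopologicalSpace M] (F : ConjClasses (A × B) → M) :
    ∑' p : ConjClasses A × ConjClasses B, F ((Equiv.ofBijective _ (ConjClasses.prod_bijective (A := A) (B := B))).symm p) = ∑' c, F c :=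
  (Equiv.ofBijective _ (ConjClasses.prod_bijective (A := A) (B := B))).symm.tsum_eq F

end Prod

/-! ## §2 The `U(J₁)`-factor: conjugacy and stable conjugacy are equality -/

section FinOne

variable {R : Type*} [CommRing R] {σ : R →+* R} {J₁ : Matrix (Fin 1) (Fin 1) R}

/-- In `U(σ, J₁) ⊂ GL₁(R)` conjugacy is equality (`1 × 1` matrices commute; ★ `isStablyConj_iff_eq_of_fin_one`). [cite: Rogawski1990, §3.1 p. 19] -/
theorem isConj_iff_eq_unitaryGroup_fin_one {x y : unitaryGroup σ J₁} : IsConj x y ↔ x = y :=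
  ⟨fun h => isStablyConj_iff_eq_of_fin_one.1 (isStablyConj_of_isConj h), fun h => h ▸ IsConj.refl _⟩

/-- `[x] = [y] ↔ x = y` in `U(σ, J₁)`. [cite: Rogawski1990, §3.1 p. 19] -/
theorem ConjClasses.mk_eq_mk_iff_eq_unitaryGroup_fin_one {x y : unitaryGroup σ J₁} : ConjClasses.mk x = ConjClasses.mk y ↔ x = y := by
  rw [ConjClasses.mk_eq_mk_iff_isConj, isConj_iff_eq_unitaryGroup_fin_one]

/-- `x ↦ [x]` is a bijection `U(σ, J₁) → ConjClasses U(σ, J₁)`. [cite: Rogawski1990, §3.1 p. 19] -/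
theorem ConjClasses.mk_bijective_unitaryGroup_fin_one :
    Function.Bijective (ConjClasses.mk : unitaryGroup σ J₁ → ConjClasses (unitaryGroup σ J₁)) :=
  ⟨fun _ _ h => ConjClasses.mk_eq_mk_iff_eq_unitaryGroup_fin_one.1 h, ConjClasses.mk_surjective⟩

/-- `x ↦ 𝒪_st(x)` is a bijection `U(σ, J₁) → StableClass σ J₁`. [cite: Rogawski1990, §3.1 p. 19] -/
theorem stableClassOf_bijective_fin_one : Function.Bijective (stableClassOf σ J₁) :=
  ⟨fun _ _ h => isStablyConj_iff_eq_of_fin_one.1 (stableClassOf_eq_iff.1 h), stableClassOf_surjective⟩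

/-- `[x] ↦ 𝒪_st(x)` is a bijection on the `U(σ, J₁)`-factor. [cite: Rogawski1990, §3.1 p. 19] -/
theorem StableClass.ofConjClass_bijective_fin_one :
    Function.Bijective (StableClass.ofConjClass : ConjClasses (unitaryGroup σ J₁) → StableClass σ J₁) := by
  constructor
  · intro c c' h
    obtain ⟨x, rfl⟩ := ConjClasses.mk_surjective c
    obtain ⟨y, rfl⟩ := ConjClasses.mk_surjective c'
    rw [StableClass.ofConjClass_mk, StableClass.ofConjClass_mk, stableClassOf_eq_iff] at h
    rw [isStablyConj_iff_eq_of_fin_one.1 h]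
  · exact StableClass.ofConjClass_surjective

end FinOne

/-! ## §3 `StableClassH ≅ StableClass σ J₂ × StableClass σ J₁` -/

section StableProd

variable {R : Type*} [CommRing R] {σ : R →+* R} {J₂ : Matrix (Fin 2) (Fin 2) R} {J₁ : Matrix (Fin 1) (Fin 1) R}

/-- `𝒪′_st(g, u) = 𝒪′_st(g′, u′) ↔ g ∼_st g′ ∧ u = u′`. [cite: Rogawski1990, §3.1 p. 19] -/
theorem stableClassHOf_mk_eq_iff {g g' : unitaryGroup σ J₂} {u u' : unitaryGroup σ J₁} :
    stableClassHOf σ J₂ J₁ (g, u) = stableClassHOf σ J₂ J₁ (g', u') ↔ IsStablyConj σ J₂ g g' ∧ u = u' := by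
  rw [stableClassHOf_eq_iff]
  exact Iff.and Iff.rfl isStablyConj_iff_eq_of_fin_one

/-- **`StableClassH σ J₂ J₁ ≅ StableClass σ J₂ × StableClass σ J₁`**: `𝒪′_st ↦ (𝒪′_st.fst, 𝒪′_st.snd)` is a bijection (stable conjugacy on `H` is
componentwise, ★ `IsStablyConjH`). [cite: Rogawski1990, §3.1 p. 19] -/
theorem StableClassH.prod_bijective : Function.Bijective (fun s : StableClassH σ J₂ J₁ => (s.fst, s.snd)) := by
  constructor
  · intro s s' h
    obtain ⟨⟨g, u⟩, rfl⟩ := stableClassHOf_surjective s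
    obtain ⟨⟨g', u'⟩, rfl⟩ := stableClassHOf_surjective s'
    simp only [StableClassH.fst_stableClassHOf, StableClassH.snd_stableClassHOf, Prod.mk.injEq, stableClassOf_eq_iff] at h
    exact stableClassHOf_eq_iff.2 h
  · rintro ⟨s₂, s₁⟩
    obtain ⟨g, rfl⟩ := stableClassOf_surjective s₂
    obtain ⟨u, rfl⟩ := stableClassOf_surjective s₁
    exact ⟨stableClassHOf σ J₂ J₁ (g, u), rfl⟩

/-- The inverse bijection sends `(𝒪_st(g), 𝒪_st(u))` to `𝒪′_st(g, u)`. [cite: Rogawski1990, §3.1 p. 19] -/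
@[simp] theorem StableClassH.prodEquiv_symm_apply_mk (g : unitaryGroup σ J₂) (u : unitaryGroup σ J₁) :
    (Equiv.ofBijective _ (StableClassH.prod_bijective (σ := σ) (J₂ := J₂) (J₁ := J₁))).symm (stableClassOf σ J₂ g, stableClassOf σ J₁ u) =
      stableClassHOf σ J₂ J₁ (g, u) :=
  (Equiv.ofBijective _ StableClassH.prod_bijective).symm_apply_eq.2 rfl

/-- **Compatibility of the two product decompositions**: `(𝒪′_st[γ_H]).fst = 𝒪_st([γ_H].fst)` and `.snd` likewise.
[cite: Rogawski1990, §3.1 p. 19] -/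
theorem StableClassH.fst_ofConjClass (c : ConjClasses (unitaryGroup σ J₂ × unitaryGroup σ J₁)) :
    (StableClassH.ofConjClass c).fst = StableClass.ofConjClass (c.map (MonoidHom.fst _ _)) := by
  obtain ⟨⟨g, u⟩, rfl⟩ := ConjClasses.mk_surjective c
  rfl

/-- See `StableClassH.fst_ofConjClass`. [cite: Rogawski1990, §3.1 p. 19] -/
theorem StableClassH.snd_ofConjClass (c : ConjClasses (unitaryGroup σ J₂ × unitaryGroup σ J₁)) :
    (StableClassH.ofConjClass c).snd = StableClass.ofConjClass (c.map (MonoidHom.snd _ _)) := by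
  obtain ⟨⟨g, u⟩, rfl⟩ := ConjClasses.mk_surjective c
  rfl

/-- Re-indexing a sum over the stable classes of `H` as a sum over pairs. [cite: Rogawski1990, §5.2 p. 69] -/
theorem finsum_stableClassH_prod {M : Type*} [AddCommMonoid M] (F : StableClassH σ J₂ J₁ → M) :
    ∑ᶠ s : StableClassH σ J₂ J₁, F s =
      ∑ᶠ p : StableClass σ J₂ × StableClass σ J₁, F ((Equiv.ofBijective _ (StableClassH.prod_bijective (σ := σ) (J₂ := J₂) (J₁ := J₁))).symm p) :=
  (finsum_comp_equiv (Equiv.ofBijective _ (StableClassH.prod_bijective (σ := σ) (J₂ := J₂) (J₁ := J₁))).symm).symm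

/-- The same for `tsum`. [cite: Rogawski1990, §5.2 p. 69] -/
theorem tsum_stableClassH_prod {M : Type*} [AddCommMonoid M] [TopologicalSpace M] (F : StableClassH σ J₂ J₁ → M) :
    ∑' p : StableClass σ J₂ × StableClass σ J₁, F ((Equiv.ofBijective _ (StableClassH.prod_bijective (σ := σ) (J₂ := J₂) (J₁ := J₁))).symm p) =
      ∑' s, F s :=
  (Equiv.ofBijective _ (StableClassH.prod_bijective (σ := σ) (J₂ := J₂) (J₁ := J₁))).symm.tsum_eq F

end StableProd

/-! ## §4 Fibres of `[γ_H] ↦ 𝒪′_st(γ_H)` and the stable orbital sum on `H` as the `U(J₂)`-stable sum of a `u`-slice -/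

section Fibre

variable {R : Type*} [CommRing R] {σ : R →+* R} {J₂ : Matrix (Fin 2) (Fin 2) R} {J₁ : Matrix (Fin 1) (Fin 1) R}

/-- **The fibre of `[γ_H] ↦ 𝒪′_st(γ_H)` over `𝒪′_st(g, u)`** is the set of classes `[(g′, u)]` with `g′ ∼_st g`: under `[(g′, u′)] ↦ ([g′], [u′])` it is
`conjClassesIn σ J₂ g ×ˢ {[u]}`. [cite: Rogawski1990, §4.1 (4.1.1) p. 39; §4.3 (4.3.1) p. 43] -/
theorem StableClassH.ofConjClass_preimage_eq (g : unitaryGroup σ J₂) (u : unitaryGroup σ J₁) :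
    StableClassH.ofConjClass ⁻¹' {stableClassHOf σ J₂ J₁ (g, u)} =
      (fun c : ConjClasses (unitaryGroup σ J₂ × unitaryGroup σ J₁) => (c.map (MonoidHom.fst _ _), c.map (MonoidHom.snd _ _))) ⁻¹'
        (conjClassesIn σ J₂ g ×ˢ {ConjClasses.mk u}) := by
  ext c
  obtain ⟨⟨g', u'⟩, rfl⟩ := ConjClasses.mk_surjective c
  rw [StableClassH.mk_mem_preimage_ofConjClass_iff, Set.mem_preimage, ConjClasses.map_fst_map_snd_mk, Set.mem_prod, mk_mem_conjClassesIn_iff,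
    Set.mem_singleton_iff, ConjClasses.mk_eq_mk_iff_eq_unitaryGroup_fin_one, eq_comm (a := u')]
  exact Iff.and Iff.rfl isStablyConj_iff_eq_of_fin_one

/-- **`Φ^st_H(𝒪′_st(g, u)) = Φ_u^st(𝒪_st(g))`** — the stable orbital sum on `H = U(J₂) × U(J₁)` is the `U(J₂)`-stable orbital sum (★ `StableClass.orbitalSum`)
of the `u`-SLICE `[g′] ↦ Φ[(g′, u)]` of the class function `Φ` (the slice read through the §1 bijection).  This is the shape in which the elliptic part of
`J_H(f^H)`, written as `Σ_{γ₁} Σ_{[g]} …` per `U(J₁)`-slice, regroups over `StableClassH`. [cite: Rogawski1990, §4.3 (4.3.1) p. 43; §5.2 p. 69] -/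
theorem StableClassH.orbitalSum_stableClassHOf_eq_slice {S : Type*} [CommRing S]
    (Φ : ConjClasses (unitaryGroup σ J₂ × unitaryGroup σ J₁) → S) (g : unitaryGroup σ J₂) (u : unitaryGroup σ J₁) :
    (stableClassHOf σ J₂ J₁ (g, u)).orbitalSum Φ =
      (stableClassOf σ J₂ g).orbitalSum fun c₂ =>
        Φ ((Equiv.ofBijective _ (ConjClasses.prod_bijective (A := unitaryGroup σ J₂) (B := unitaryGroup σ J₁))).symm (c₂, ConjClasses.mk u)) := by
  set e := Equiv.ofBijective _ (ConjClasses.prod_bijective (A := unitaryGroup σ J₂) (B := unitaryGroup σ J₁)) with he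
  rw [StableClassH.orbitalSum_eq_finsum_mem_preimage, StableClass.orbitalSum_stableClassOf, stableOrbitalSum,
    StableClassH.ofConjClass_preimage_eq]
  -- `Σᶠ_{c ∈ e⁻¹(T ×ˢ {[u]})} Φ c = Σᶠ_{c₂ ∈ T} Φ (e.symm (c₂, [u]))` along the bijection `c₂ ↦ e.symm (c₂, [u])`
  change ∑ᶠ c ∈ e ⁻¹' (conjClassesIn σ J₂ g ×ˢ {ConjClasses.mk u}), Φ c = _
  refine (finsum_mem_eq_of_bijOn (fun c₂ => e.symm (c₂, ConjClasses.mk u)) ⟨?_, ?_, ?_⟩ fun _ _ => rfl).symm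
  · intro c₂ hc₂
    rw [Set.mem_preimage, Equiv.apply_symm_apply]
    exact Set.mk_mem_prod hc₂ rfl
  · intro c₂ _ c₂' _ h
    have h' := congrArg Prod.fst (e.symm.injective h)
    exact h'
  · intro c hc
    rw [Set.mem_preimage, Set.mem_prod, Set.mem_singleton_iff] at hc
    refine ⟨(e c).1, hc.1, ?_⟩
    change e.symm ((e c).1, ConjClasses.mk u) = c
    rw [← hc.2, Prod.mk.eta, Equiv.symm_apply_apply]

end Fibre

/-! ## §5 Regrouping over `StableClassH`: all stable classes at once, and summable class functions -/

section Regroup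

variable {R : Type*} [CommRing R] {σ : R →+* R} {J₂ : Matrix (Fin 2) (Fin 2) R} {J₁ : Matrix (Fin 1) (Fin 1) R}

/-- **`Σ_{𝒪′_st} Φ^st_H(𝒪′_st) = Σ_{u ∈ U(J₁)} Σ_{𝒪_st ⊂ U(J₂)} Φ_u^st(𝒪_st)`** (finitely supported sums, `finsum`): the sum of the `H`-stable orbital sums
over all stable classes of `H` is the iterated sum, over the `U(J₁)`-coordinate `u` and the stable classes of `U(J₂)`, of the stable orbital sums of the
`u`-slices (§3 bijection + `StableClassH.orbitalSum_stableClassHOf_eq_slice`). [cite: Rogawski1990, §5.2 p. 69; §4.3 (4.3.1) p. 43] -/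
theorem finsum_stableClassH_orbitalSum_eq_finsum_slice {S : Type*} [CommRing S]
    (Φ : ConjClasses (unitaryGroup σ J₂ × unitaryGroup σ J₁) → S) :
    ∑ᶠ s : StableClassH σ J₂ J₁, s.orbitalSum Φ =
      ∑ᶠ p : StableClass σ J₂ × unitaryGroup σ J₁,
        p.1.orbitalSum fun c₂ =>
          Φ ((Equiv.ofBijective _ (ConjClasses.prod_bijective (A := unitaryGroup σ J₂) (B := unitaryGroup σ J₁))).symm (c₂, ConjClasses.mk p.2)) := by
  -- re-index along `StableClassH ≃ StableClass σ J₂ × StableClass σ J₁ ≃ StableClass σ J₂ × U(σ, J₁)`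
  let e₁ := Equiv.ofBijective _ (StableClassH.prod_bijective (σ := σ) (J₂ := J₂) (J₁ := J₁))
  let e₂ : StableClass σ J₂ × unitaryGroup σ J₁ ≃ StableClass σ J₂ × StableClass σ J₁ :=
    Equiv.prodCongr (Equiv.refl _) (Equiv.ofBijective _ (stableClassOf_bijective_fin_one (σ := σ) (J₁ := J₁)))
  rw [← finsum_comp_equiv (e₂.trans e₁.symm)]
  refine finsum_congr fun p => ?_
  obtain ⟨s₂, u⟩ := p
  obtain ⟨g, rfl⟩ := stableClassOf_surjective s₂
  have h1 : (e₂.trans e₁.symm) (stableClassOf σ J₂ g, u) = stableClassHOf σ J₂ J₁ (g, u) := by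
    change e₁.symm (stableClassOf σ J₂ g, stableClassOf σ J₁ u) = _
    exact StableClassH.prodEquiv_symm_apply_mk g u
  rw [h1, StableClassH.orbitalSum_stableClassHOf_eq_slice]

variable {E : Type*} [NormedAddCommGroup E] [CompleteSpace E]

/-- **`Σ_{[γ_H]} Φ = Σ_{𝒪′_st} Σ'_{[γ_H] ⊂ 𝒪′_st} Φ` for (absolutely) summable class functions on `H`** with values in a complete normed group
(Mathlib `HasSum.tsum_fiberwise`; the `H`-twin of ★ `hasSum_stableClass_tsum_fibre`). [cite: Rogawski1990, §5.2 p. 69] -/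
theorem hasSum_stableClassH_tsum_fibre {Φ : ConjClasses (unitaryGroup σ J₂ × unitaryGroup σ J₁) → E} {a : E} (h : HasSum Φ a) :
    HasSum (fun s : StableClassH σ J₂ J₁ => ∑' c : ↥(StableClassH.ofConjClass ⁻¹' {s}), Φ c) a :=
  h.tsum_fiberwise StableClassH.ofConjClass

/-- `Σ'_{𝒪′_st} Σ'_{[γ_H] ⊂ 𝒪′_st} Φ = Σ'_{[γ_H]} Φ` for summable `Φ`. [cite: Rogawski1990, §5.2 p. 69] -/
theorem tsum_stableClassH_tsum_fibre {Φ : ConjClasses (unitaryGroup σ J₂ × unitaryGroup σ J₁) → E} (h : Summable Φ) :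
    ∑' s : StableClassH σ J₂ J₁, ∑' c : ↥(StableClassH.ofConjClass ⁻¹' {s}), Φ c = ∑' c, Φ c :=
  (hasSum_stableClassH_tsum_fibre h.hasSum).tsum_eq

/-- For finitely supported `Φ` the inner `tsum` over a fibre is the finite `Φ^st_H(𝒪′_st)` (★ `StableClassH.orbitalSum`). [cite: Rogawski1990, §4.3 (4.3.1) p. 43] -/
theorem StableClassH.tsum_fibre_eq_orbitalSum {S : Type*} [NormedCommRing S] (Φ : ConjClasses (unitaryGroup σ J₂ × unitaryGroup σ J₁) → S)
    (hΦ : (Function.support Φ).Finite) (s : StableClassH σ J₂ J₁) :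
    ∑' c : ↥(StableClassH.ofConjClass ⁻¹' {s}), Φ c = s.orbitalSum Φ := by
  rw [StableClassH.orbitalSum_eq_finsum_mem_preimage, ← finsum_set_coe_eq_finsum_mem]
  refine tsum_eq_finsum ?_
  change (Function.support (Φ ∘ Subtype.val)).Finite
  rw [Function.support_comp_eq_preimage]
  exact hΦ.preimage Subtype.val_injective.injOn

end Regroup

end Literature.NumberTheory.Rogawski1990
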